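import Mathlib
import Summits.Ventures.HodgeRepro.Tier4.Line4.LevelTailHav
import Summits.Ventures.HodgeRepro.Tier4.Line4.LevelTailDecay
import Summits.Ventures.HodgeRepro.Tier4.Line4.LevelTailConv
import Summits.Ventures.HodgeRepro.Tier4.Line4.NaturalWitnessMu
import Summits.Ventures.HodgeRepro.Tier4.Line4.SublevelCountBase
import Summits.Ventures.HodgeRepro.Tier4.Line4.RtfGeometricL1
import Summits.Ventures.HodgeRepro.Tier4.Line4.GeometricBridge
import Summits.Ventures.HodgeRepro.Tier4.Line4.L1ClassV4
import Summits.Ventures.HodgeRepro.Tier4.Common.L1Convolution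

/-!
# Tier4/Line4/TailGlue — C-L4-TAIL-GLUE: the (7b) display as a THEOREM modulo its named displays

Blind re-derivation cell `pub-hodge-repro`, Tier 4 «prove the step» (README §9–§10), LINE L4, seat t4-x2 (g5, reserve
wall-breaker; plan-4 g5's S15269 «THEN the full (7b) glue», S15355 (2) / S15357 «the GLUE first»).  Tree path
`lean/Summits/Ventures/HodgeRepro/Tier4/Line4/TailGlue.lean`.  Mathlib-level; no literature; no `def`.

WHAT.  The wall's display (7b) `TailForArch'''` (L4 skeleton v0.38, (R-34)) asks, for every decaying archimedean
coefficient `finf` at the rational `γ₀`, a level sequence `lev` (all levels `≠ 0`), a level family `(ffin, f₂)` in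
`TailFamily'` and a finite set `E ∋ orbitOf γ₀` of orbits such that the fibre sum dominates the off-fibre remainder of
`J((finf ⊗ ffin (lev n)) ⋆ f₂ (lev n))` from some `n` on (`FibreDominatedFrom`).  THIS MODULE proves that package for the
WITNESS OF RECORD — `lev n := p ^ (n + n₁)` (`p` a prime, `n₁` the separation threshold), `ffin := ffinMuNat μ₀ γ₀ lev`
(the `μ₀(K(N))⁻¹`-normalised indicator of `K(N) γ₀,f K(N)`, L1-p1's NaturalWitnessMu), `f₂ := testNat e` (the product
test `e ⊗ 1_{K(N)}`), `E := {orbitOf γ₀}` — from the level-measure assembly `exists_fibreDominated_of_level_decay_count`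
(LevelTail p704492), every binder of which is discharged BY NAME except the displays of (7b), which are the hypotheses of
the theorem below (each a lemma hypothesis, never a wall binder — crit-1 S15224 (3)):

* (S-IDX)   `hidx` — the double-coset index bound along `lev` (L4-p2's C-L4-INDEXBOUND; `TailFamily'.l1`);
* (S-SEP)   `hsep` — the transporter separation from the level `p^{n₁}` on (L2-p3's `exists_level_separates_transporter`,
            TransporterSeparation p707094, after `obtain ⟨n₁, hsep⟩`);
* (S-RATIO) `hratio` — the folded support measure off the transporter is `≤ C′ ×` the unit `(suppMeasure (lev N) γ₀).toReal`;
* (S-UNIT)  `hv` — the unit is positive (L2-p1's `suppMeasure_toReal_pos`, SuppMeasureFinite v2, with the choice of `DZf`);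
* (S-COUNT) `hcount` — `SublevelCount₀ W S` (L4-p2's SublevelCountBase p703428);
* (S-SPARSE) `hg`, `hR` — the coset-sparsity threshold `g N → ∞` off the fibre at the rational point (L1-p3's
            OrbitInvariantFinite v2 / OrbitInvariantDenominator + the fibre bridge of (S-DICH));
* (S-MAIN)  `hmain` — the main term at `γ₀` is `≥ m ×` the unit from some level on (L2-p1's LevelIndicator through the
            HorbMain chain at the indicator finite factor and the archimedean `arch_ne`).

Everything else is BY NAME: continuity and the Poincaré clause of the convolution family (`continuous_conv_of_integrable_of_isTest`,
`poincareOfConv_holds`), the level-uniform decay (L2-p2's `hdecay_of_convDecay`, LevelTailDecay p705752), the level sets and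
their measurability / support clause (L2-p1's LevelTailInstance p705148 / LevelTailConv p705648), the `hAv` block
(LevelTailHav p706666), the characters (`isCharacter_chi` / `isCharacter'_chi'`), the family (`tailFamily'_naturalMu`).

* **`fibreDominatedFrom_conv_of_displays`** — the domination for the witness of record, from the seven displays.
* **`exists_levelFamily_fibreDominated_of_displays`** — the existential package of `TailForArch'''` (its body, in tree
  vocabulary: `∃ lev, (∀ n, lev n ≠ 0) ∧ ∃ ffin f₂, TailFamily' … ∧ ∃ E, orbitOf γ₀ ∈ E ∧ FibreDominatedFrom …`), for the
  skeleton's `l4_tailForArch` to bind by name once the displays are instantiated.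

Nothing here says anything about the status of the Hodge conjecture for CM abelian varieties, which is NOT proved
(HC_CM is NOT proved by anyone in this repository).
-/

set_option autoImplicit false

noncomputable section

namespace Summit.Ventures.HodgeRepro.Tier4.Line4

open MeasureTheory Topology Filter NumberField Summit.Ventures.HodgeRepro.Tier4 Summit.Ventures.HodgeRepro.Tier4.Common
  Summit.Ventures.HodgeRepro.Tier4.Line1 Summit.Ventures.HodgeRepro.Tier4.Line1.RTF
  Summit.Ventures.HodgeRepro.Tier4.Line4.L1Class

open scoped ENNReal Pointwise

section Glue

variable {k : Type} [Field k] [NumberField k] (W : PlaneData k) [MeasurableSpace (GA W)] [BorelSpace (GA W)]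
  (R : RTFData W) (μ : Measure (GA W)) [μ.IsHaarMeasure] [R.μT.IsHaarMeasure] [R.μT'.IsHaarMeasure]
  (DG : Set (GA W)) (fdG : IsFundamentalDomain (rationalPoints W) DG μ) (compG : IsCompact (closure DG))
  (compT : IsCompact (closure R.DT)) (compT' : IsCompact (closure R.DT'))

/-- **THE (7b) GLUE — the fibre domination for the witness of record, from the seven displays.**  Level sequence
`lev n := p ^ (n + n₁)`, family `(ffinMuNat μ₀ γ₀ lev, testNat e)`, fibre `E = {orbitOf γ₀}`, unit
`v N := C′ · (suppMeasure (lev N) γ₀).toReal`; the assembly is LevelTail's `exists_fibreDominated_of_level_decay_count`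
at `d := archDist`, `β := 3`, `α` from (S-COUNT) on the compact `Kf := (D_T)_f · K(p^{n₁}) γ₀,f K(p^{n₁}) · (D_{T′})_f⁻¹`. -/
theorem fibreDominatedFrom_conv_of_displays (hRH : R.IsHaar)
    (hc : Continuous R.chi) (hu : ∀ a, ‖R.chi a‖ = 1) (hc' : Continuous R.chi') (hu' : ∀ a, ‖R.chi' a‖ = 1)
    (q : QuadData k) (g g' : Matrix (Fin 4) (Fin 4) k) (w₀ : InfinitePlace k) (eP eM eP' eM' : InfinitePlace k → ℤ)
    (γ₀ : (Setting.ofAdelicData W R μ DG fdG compG compT compT').Gk)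
    (νinf : Measure (torusInf W)) (νinf' : Measure (torusInf' W)) (finf : GA W → ℂ)
    (hfinf : IsArchCoeffD W (Setting.ofAdelicData W R μ DG fdG compG compT compT') R q g g' w₀ eP eM eP' eM'
      (γ₀ : GA W) νinf νinf' finf)
    (μ₀ : Measure (finitePart W)) [μ₀.IsHaarMeasure] {e : GA W → ℂ} (he : IsInfFactor W e)
    (hequiv : ∀ (w : InfinitePlace k) (κ : GA W), κ ∈ localTorusAt' W w → ∀ x,
      e (x * κ) = weightAt' W q w g g' 0 κ ^ (-eP' w) * weightAt' W q w g g' 1 κ ^ (-eM' w) * e x)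
    (p n₁ : ℕ) (hp : p ≠ 0)
    -- (S-IDX)
    (hidx : ∃ M₁ : ℝ, ∀ n : ℕ, (μ₀ (levelDoubleCosetSet W (γ₀ : GA W) (p ^ (n + n₁)))).toReal ≤
      M₁ * (μ₀ (levelKSet W (p ^ (n + n₁)))).toReal)
    -- (S-SEP)
    (hsep : ∀ n ≥ n₁, ∀ γ : rationalPoints W,
      (torusT W).map (MulAut.conj ((γ : GA W))⁻¹).toMonoidHom = torusT' W →
      ∀ t ∈ torusT W, ∀ t' ∈ torusT' W,
        GA.ofFinPart W (t⁻¹ * (γ : GA W) * t') ∉ levelDoubleCoset W (p ^ n) (GA.ofFinPart W (γ₀ : GA W)))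
    -- (S-RATIO) and (S-UNIT), in the unit `u N := (suppMeasure (lev N) γ₀).toReal`
    (νf : Measure (torusFin W)) (νf' : Measure (torusFin' W)) (DZf : Set (torusFin W)) (C' : ℝ) (hC' : 0 < C')
    (hratio : ∀ (N : ℕ) (γ : rationalPoints W),
      ¬ ((torusT W).map (MulAut.conj ((γ : GA W))⁻¹).toMonoidHom = torusT' W) →
      (suppMeasureFolded W R (γ₀ : GA W) (p ^ (N + n₁)) (γ : GA W)).toReal ≤
        C' * (suppMeasure W νf νf' (γ₀ : GA W) DZf (p ^ (N + n₁)) (γ₀ : GA W)).toReal)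
    (hv : ∀ N : ℕ, 0 < (suppMeasure W νf νf' (γ₀ : GA W) DZf (p ^ (N + n₁)) (γ₀ : GA W)).toReal)
    -- (S-COUNT)
    (hcount : SublevelCount₀ W (Setting.ofAdelicData W R μ DG fdG compG compT compT'))
    -- (S-SPARSE)
    (gth : ℕ → ℝ) (hg : Tendsto gth atTop atTop)
    (hR : ∀ (N : ℕ) (γ : (Setting.ofAdelicData W R μ DG fdG compG compT compT').Gk),
      (Setting.ofAdelicData W R μ DG fdG compG compT compT').orbitOf γ ∉
        ({(Setting.ofAdelicData W R μ DG fdG compG compT compT').orbitOf γ₀} :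
          Finset (Setting.ofAdelicData W R μ DG fdG compG compT compT').Orbit) →
      (∃ t ∈ R.DT, ∃ t' ∈ R.DT',
        (Setting.ofAdelicData W R μ DG fdG compG compT compT').conv
          (prodFn W finf (ffinMuNat W μ₀ (γ₀ : GA W) (fun n => p ^ (n + n₁)) (p ^ (N + n₁))))
          (testNat W e (p ^ (N + n₁))) ((t : GA W)⁻¹ * γ * (t' : GA W)) ≠ 0) →
      gth N ≤ archDist W (γ : GA W))
    -- (S-MAIN)
    (hmain : ∃ m : ℝ, 0 < m ∧ ∃ N₁ : ℕ, ∀ N ≥ N₁,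
      m * (C' * (suppMeasure W νf νf' (γ₀ : GA W) DZf (p ^ (N + n₁)) (γ₀ : GA W)).toReal) ≤
        ‖(Setting.ofAdelicData W R μ DG fdG compG compT compT').orbital R.chi R.chi'
          ((Setting.ofAdelicData W R μ DG fdG compG compT compT').orbitOf γ₀)
          ((Setting.ofAdelicData W R μ DG fdG compG compT compT').conv
            (prodFn W finf (ffinMuNat W μ₀ (γ₀ : GA W) (fun n => p ^ (n + n₁)) (p ^ (N + n₁))))
            (testNat W e (p ^ (N + n₁))))‖) :
    TailFamily' W q g g' eP' eM' (γ₀ : GA W) (ffinMuNat W μ₀ (γ₀ : GA W) (fun n => p ^ (n + n₁))) (testNat W e) ∧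
    FibreDominatedFrom (Setting.ofAdelicData W R μ DG fdG compG compT compT') R.chi R.chi'
      {(Setting.ofAdelicData W R μ DG fdG compG compT compT').orbitOf γ₀}
      (fun n => (Setting.ofAdelicData W R μ DG fdG compG compT compT').conv
        (prodFn W finf (ffinMuNat W μ₀ (γ₀ : GA W) (fun n => p ^ (n + n₁)) (p ^ (n + n₁))))
        (testNat W e (p ^ (n + n₁)))) := by
  -- the setting and its instances
  haveI := secondCountable_GA W
  haveI := sigmaCompact_GA W
  haveI := locallyCompactSpace_GA W
  have hfam : TailFamily' W q g g' eP' eM' (γ₀ : GA W) (ffinMuNat W μ₀ (γ₀ : GA W) (fun n => p ^ (n + n₁)))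
      (testNat W e) :=
    tailFamily'_naturalMu W μ₀ (γ₀ : GA W) q g g' eP' eM' (fun n => p ^ (n + n₁)) he hequiv hidx
  refine ⟨hfam, ?_⟩
  have hlev : ∀ N : ℕ, p ^ (N + n₁) ≠ 0 := fun N => pow_ne_zero _ hp
  have hdvd : ∀ N : ℕ, p ^ n₁ ∣ p ^ (N + n₁) := fun N => pow_dvd_pow p (Nat.le_add_left n₁ N)
  have hχ : (Setting.ofAdelicData W R μ DG fdG compG compT compT').IsCharacter R.chi :=
    isCharacter_chi W R μ DG fdG compG compT compT' hc hu
  have hχ' : (Setting.ofAdelicData W R μ DG fdG compG compT compT').IsCharacter' R.chi' :=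
    isCharacter'_chi' W R μ DG fdG compG compT compT' hc' hu'
  -- continuity and the Poincaré clause of the family, by name
  have hf : ∀ N : ℕ, Continuous ((Setting.ofAdelicData W R μ DG fdG compG compT compT').conv
      (prodFn W finf (ffinMuNat W μ₀ (γ₀ : GA W) (fun n => p ^ (n + n₁)) (p ^ (N + n₁))))
      (testNat W e (p ^ (N + n₁)))) := fun N =>
    continuous_conv_of_integrable_of_isTest _ (continuous_prodFn W hfinf.cont (hfam.fin _).cont)
      (hfinf.integrable _ (hfam.fin _)) ⟨(hfam.test₂ _).1, (hfam.test₂ _).2⟩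
  have hP : ∀ N : ℕ, PoincareSummable (Setting.ofAdelicData W R μ DG fdG compG compT compT')
      ((Setting.ofAdelicData W R μ DG fdG compG compT compT').conv
        (prodFn W finf (ffinMuNat W μ₀ (γ₀ : GA W) (fun n => p ^ (n + n₁)) (p ^ (N + n₁))))
        (testNat W e (p ^ (N + n₁)))) := fun N =>
    poincareOfConv_holds _ _ _ ⟨continuous_prodFn W hfinf.cont (hfam.fin _).cont, hfinf.integrable _ (hfam.fin _)⟩
      ⟨(hfam.test₂ _).1, (hfam.test₂ _).2⟩
  -- the level-uniform decay, by name (L2-p2)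
  obtain ⟨C, hC, hdec⟩ := hdecay_of_convDecay W (Setting.ofAdelicData W R μ DG fdG compG compT compT') hfinf.decay
    (ffinMuNat W μ₀ (γ₀ : GA W) (fun n => p ^ (n + n₁))) (testNat W e) hfam.fin hfam.l1 hfam.sup₂ hfam.supp₂
  -- the compact of the finite parts of the relevant rational points
  have hKf₀ : IsCompact (levelDoubleCoset W (p ^ n₁) (GA.ofFinPart W (γ₀ : GA W))) :=
    isCompact_levelDoubleCoset W (pow_ne_zero _ hp) _
  have hF₁ : IsCompact (GA.ofFinPart W '' (Subtype.val '' closure R.DT)) :=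
    (compT.image continuous_subtype_val).image (continuous_ofFinPart W)
  have hF₂ : IsCompact (GA.ofFinPart W '' (Subtype.val '' closure R.DT')) :=
    (compT'.image continuous_subtype_val).image (continuous_ofFinPart W)
  have hKfc : IsCompact ((GA.ofFinPart W '' (Subtype.val '' closure R.DT)) *
      levelDoubleCoset W (p ^ n₁) (GA.ofFinPart W (γ₀ : GA W)) * (GA.ofFinPart W '' (Subtype.val '' closure R.DT'))⁻¹) :=
    (hF₁.mul hKf₀).mul hF₂.inv
  have hKffin : (GA.ofFinPart W '' (Subtype.val '' closure R.DT)) *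
      levelDoubleCoset W (p ^ n₁) (GA.ofFinPart W (γ₀ : GA W)) * (GA.ofFinPart W '' (Subtype.val '' closure R.DT'))⁻¹ ⊆
      (finitePart W : Set (GA W)) := by
    rintro _ ⟨_, ⟨_, ⟨x, _, rfl⟩, z, hz, rfl⟩, _, hy, rfl⟩
    refine Subgroup.mul_mem _ (Subgroup.mul_mem _ (ofFinPart_mem_finitePart W x)
      (levelDoubleCoset_subset_finitePart W (γ₀ : GA W) (p ^ n₁) hz)) ?_
    rw [Set.mem_inv] at hy
    obtain ⟨y, _, hyy⟩ := hy
    have hy' := ofFinPart_mem_finitePart W y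
    rw [hyy] at hy'
    exact (Subgroup.inv_mem_iff _).1 hy'
  obtain ⟨Cc, α, hCc0, hα, hcnt⟩ := hcount _ hKfc hKffin
  -- the assembly of record
  have hdom := exists_fibreDominated_of_level_decay_count (Setting.ofAdelicData W R μ DG fdG compG compT compT')
    (fun N => (Setting.ofAdelicData W R μ DG fdG compG compT compT').conv
      (prodFn W finf (ffinMuNat W μ₀ (γ₀ : GA W) (fun n => p ^ (n + n₁)) (p ^ (N + n₁))))
      (testNat W e (p ^ (N + n₁))))
    hf hP (fun γ => archDist W (γ : GA W)) hC hα (by norm_num) hχ hχ'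
    {(Setting.ofAdelicData W R μ DG fdG compG compT compT').orbitOf γ₀}
    (fun N γ _ t ht t' ht' => hdec (p ^ (N + n₁)) γ t ht t' ht')
    (fun N γ => levelSuppSet W (γ₀ : GA W) (p ^ (N + n₁)) (γ : GA W))
    (fun N γ _ => measurableSet_levelSuppSet W (γ₀ : GA W) (hlev N) (γ : GA W))
    (fun N γ _ t _ t' _ h => mem_levelSuppSet_conv W (Setting.ofAdelicData W R μ DG fdG compG compT compT')
      (γ₀ : GA W) finf _ _ (p ^ (N + n₁)) (hfam.suppFin _) (hfam.suppFin₂ _) (γ : GA W) t t' h)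
    (fun N => C' * (suppMeasure W νf νf' (γ₀ : GA W) DZf (p ^ (N + n₁)) (γ₀ : GA W)).toReal)
    (hv_of_pos hC' hv)
    (hAv_levelSuppSet_of_sep_ratio W R μ DG fdG compG compT compT' hRH (γ₀ : GA W) (fun n => p ^ (n + n₁)) hlev
      (fun γ => (torusT W).map (MulAut.conj ((γ : GA W))⁻¹).toMonoidHom = torusT' W) C'
      (fun N => (suppMeasure W νf νf' (γ₀ : GA W) DZf (p ^ (N + n₁)) (γ₀ : GA W)).toReal)
      (fun N γ hγ => hsep (N + n₁) (Nat.le_add_left n₁ N) γ hγ) hratio _)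
    (fun γ => GA.ofFinPart W (γ : GA W) ∈ (GA.ofFinPart W '' (Subtype.val '' closure R.DT)) *
      levelDoubleCoset W (p ^ n₁) (GA.ofFinPart W (γ₀ : GA W)) * (GA.ofFinPart W '' (Subtype.val '' closure R.DT'))⁻¹)
    (fun N γ _ h => by
      obtain ⟨t, ht, t', ht', hne⟩ := h
      have hmem := mem_levelSuppSet_conv W (Setting.ofAdelicData W R μ DG fdG compG compT compT') (γ₀ : GA W) finf _ _
        (p ^ (N + n₁)) (hfam.suppFin _) (hfam.suppFin₂ _) (γ : GA W) t t' hne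
      have hz : GA.ofFinPart W ((t : GA W)⁻¹ * γ * (t' : GA W)) ∈
          levelDoubleCoset W (p ^ n₁) (GA.ofFinPart W (γ₀ : GA W)) :=
        levelDoubleCoset_antitone W (hdvd N) _ hmem
      have heq : GA.ofFinPart W (γ : GA W) = GA.ofFinPart W (t : GA W) *
          GA.ofFinPart W ((t : GA W)⁻¹ * γ * (t' : GA W)) * (GA.ofFinPart W (t' : GA W))⁻¹ := by
        rw [ofFinPart_mul, ofFinPart_mul, ofFinPart_inv]
        group
      rw [heq]
      refine Set.mul_mem_mul (Set.mul_mem_mul ⟨(t : GA W), ⟨t, subset_closure ht, rfl⟩, rfl⟩ hz) ?_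
      rw [Set.mem_inv, inv_inv]
      exact ⟨(t' : GA W), ⟨t', subset_closure ht', rfl⟩, rfl⟩)
    ⟨Cc, hCc0, hcnt⟩ gth hg hR
    (by
      obtain ⟨m, hm, N₁, hN₁⟩ := hmain
      exact ⟨m, hm, N₁, fun N hN => by simpa only [Finset.sum_singleton] using hN₁ N hN⟩)
  exact hdom

/-- **THE EXISTENTIAL PACKAGE OF (7b)** for the witness of record (the body of the skeleton's `TailForArch'''`, in tree
vocabulary): from the seven displays, `∃ lev, (∀ n, lev n ≠ 0) ∧ ∃ ffin f₂, TailFamily' … ∧ ∃ E, orbitOf γ₀ ∈ E ∧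
FibreDominatedFrom S χ χ' E ((finf ⊗ ffin (lev ·)) ⋆ f₂ (lev ·))`. -/
theorem exists_levelFamily_fibreDominated_of_displays (hRH : R.IsHaar)
    (hc : Continuous R.chi) (hu : ∀ a, ‖R.chi a‖ = 1) (hc' : Continuous R.chi') (hu' : ∀ a, ‖R.chi' a‖ = 1)
    (q : QuadData k) (g g' : Matrix (Fin 4) (Fin 4) k) (w₀ : InfinitePlace k) (eP eM eP' eM' : InfinitePlace k → ℤ)
    (γ₀ : (Setting.ofAdelicData W R μ DG fdG compG compT compT').Gk)
    (νinf : Measure (torusInf W)) (νinf' : Measure (torusInf' W)) (finf : GA W → ℂ)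
    (hfinf : IsArchCoeffD W (Setting.ofAdelicData W R μ DG fdG compG compT compT') R q g g' w₀ eP eM eP' eM'
      (γ₀ : GA W) νinf νinf' finf)
    (μ₀ : Measure (finitePart W)) [μ₀.IsHaarMeasure] {e : GA W → ℂ} (he : IsInfFactor W e)
    (hequiv : ∀ (w : InfinitePlace k) (κ : GA W), κ ∈ localTorusAt' W w → ∀ x,
      e (x * κ) = weightAt' W q w g g' 0 κ ^ (-eP' w) * weightAt' W q w g g' 1 κ ^ (-eM' w) * e x)
    (p n₁ : ℕ) (hp : p ≠ 0)
    (hidx : ∃ M₁ : ℝ, ∀ n : ℕ, (μ₀ (levelDoubleCosetSet W (γ₀ : GA W) (p ^ (n + n₁)))).toReal ≤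
      M₁ * (μ₀ (levelKSet W (p ^ (n + n₁)))).toReal)
    (hsep : ∀ n ≥ n₁, ∀ γ : rationalPoints W,
      (torusT W).map (MulAut.conj ((γ : GA W))⁻¹).toMonoidHom = torusT' W →
      ∀ t ∈ torusT W, ∀ t' ∈ torusT' W,
        GA.ofFinPart W (t⁻¹ * (γ : GA W) * t') ∉ levelDoubleCoset W (p ^ n) (GA.ofFinPart W (γ₀ : GA W)))
    (νf : Measure (torusFin W)) (νf' : Measure (torusFin' W)) (DZf : Set (torusFin W)) (C' : ℝ) (hC' : 0 < C')
    (hratio : ∀ (N : ℕ) (γ : rationalPoints W),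
      ¬ ((torusT W).map (MulAut.conj ((γ : GA W))⁻¹).toMonoidHom = torusT' W) →
      (suppMeasureFolded W R (γ₀ : GA W) (p ^ (N + n₁)) (γ : GA W)).toReal ≤
        C' * (suppMeasure W νf νf' (γ₀ : GA W) DZf (p ^ (N + n₁)) (γ₀ : GA W)).toReal)
    (hv : ∀ N : ℕ, 0 < (suppMeasure W νf νf' (γ₀ : GA W) DZf (p ^ (N + n₁)) (γ₀ : GA W)).toReal)
    (hcount : SublevelCount₀ W (Setting.ofAdelicData W R μ DG fdG compG compT compT'))
    (gth : ℕ → ℝ) (hg : Tendsto gth atTop atTop)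
    (hR : ∀ (N : ℕ) (γ : (Setting.ofAdelicData W R μ DG fdG compG compT compT').Gk),
      (Setting.ofAdelicData W R μ DG fdG compG compT compT').orbitOf γ ∉
        ({(Setting.ofAdelicData W R μ DG fdG compG compT compT').orbitOf γ₀} :
          Finset (Setting.ofAdelicData W R μ DG fdG compG compT compT').Orbit) →
      (∃ t ∈ R.DT, ∃ t' ∈ R.DT',
        (Setting.ofAdelicData W R μ DG fdG compG compT compT').conv
          (prodFn W finf (ffinMuNat W μ₀ (γ₀ : GA W) (fun n => p ^ (n + n₁)) (p ^ (N + n₁))))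
          (testNat W e (p ^ (N + n₁))) ((t : GA W)⁻¹ * γ * (t' : GA W)) ≠ 0) →
      gth N ≤ archDist W (γ : GA W))
    (hmain : ∃ m : ℝ, 0 < m ∧ ∃ N₁ : ℕ, ∀ N ≥ N₁,
      m * (C' * (suppMeasure W νf νf' (γ₀ : GA W) DZf (p ^ (N + n₁)) (γ₀ : GA W)).toReal) ≤
        ‖(Setting.ofAdelicData W R μ DG fdG compG compT compT').orbital R.chi R.chi'
          ((Setting.ofAdelicData W R μ DG fdG compG compT compT').orbitOf γ₀)
          ((Setting.ofAdelicData W R μ DG fdG compG compT compT').conv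
            (prodFn W finf (ffinMuNat W μ₀ (γ₀ : GA W) (fun n => p ^ (n + n₁)) (p ^ (N + n₁))))
            (testNat W e (p ^ (N + n₁))))‖) :
    ∃ lev : ℕ → ℕ, (∀ n, lev n ≠ 0) ∧
    ∃ ffin f₂ : ℕ → GA W → ℂ, TailFamily' W q g g' eP' eM' (γ₀ : GA W) ffin f₂ ∧
      ∃ E : Finset (Setting.ofAdelicData W R μ DG fdG compG compT compT').Orbit,
        (Setting.ofAdelicData W R μ DG fdG compG compT compT').orbitOf γ₀ ∈ E ∧
        FibreDominatedFrom (Setting.ofAdelicData W R μ DG fdG compG compT compT') R.chi R.chi' E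
          (fun n => (Setting.ofAdelicData W R μ DG fdG compG compT compT').conv
            (prodFn W finf (ffin (lev n))) (f₂ (lev n))) := by
  obtain ⟨hfam, hdom⟩ := fibreDominatedFrom_conv_of_displays W R μ DG fdG compG compT compT' hRH hc hu hc' hu'
    q g g' w₀ eP eM eP' eM' γ₀ νinf νinf' finf hfinf μ₀ he hequiv p n₁ hp hidx hsep νf νf' DZf C' hC' hratio hv
    hcount gth hg hR hmain
  exact ⟨fun n => p ^ (n + n₁), fun n => pow_ne_zero _ hp, _, _, hfam, _, Finset.mem_singleton_self _, hdom⟩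

end Glue

end Summit.Ventures.HodgeRepro.Tier4.Line4

end
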